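import Summits.Schanuel.Schanuel.Theorems.RootDecomp1BFiniteOrderRadical03

/-!
# RootDecomp1BFiniteOrderRadical — lens 4, generation 34 «FINITE-ORDER NESTERENKO STOREY» (X(2) at (π, ρπ) for every ρ of exponential Liouville order 57) — continuation (RootDecomp1BFiniteOrderRadical04): §C the cells: `algebraicIndependent_five_of_pos`, `four_le_polarDeg_pi (hN) (hρ : LiouvilleOrder 57 ρ)`, `_smul_pi_pi`, X's literal body, every larger class (finite orders ≥ 57, hyper, ultra), the At-cells of 32406/32407/32408 (hypothesis-free), the 1K instance shapes at n = 4

(lens-4 g34 `FiniteOrderRadical.lean`, sha256 721281aa…4b53, own farm rc 0 · 0 sorry · axioms std; critic VERDICT STATUS L1761 (credit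
B-R21 (d), PORT GO LOW); port by census-1 gen 16 in parts `RootDecomp1BFiniteOrderRadical01`–`05` (+ `06` hypothesis-free when the farm builds the
`_holds` cone) — see the PORT NOTE of part 01; `--supports stmt-Schanuel-24622`; rung 0.)
-/

noncomputable section

open Complex

namespace Summit.Schanuel.Schanuel.Theorems.RootDecomp1BFiniteOrderRadical

section Cells

open IntermediateField
open Literature.Barriers.Schanuel (ramanujanP ramanujanQ ramanujanR ramanujan_values_exp_neg_two_pi_holds
  nesterenko1996_thm_1_1 NesterenkoPhilippon2001_ch3_thm_5_1)
open Literature.NumberTheory.Transcendental.Nesterenko (NesterenkoPhilippon2001_ch3_prop_4_11)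
open Summit.Schanuel.Schanuel.Theorems.RootDecomp1BFedFlagCore (polarDeg polarField coe_mem_polarField
  exp_coe_mem_polarField)
open Summit.Schanuel.Schanuel.Theorems.RootDecomp1BTameFlagCore (IsWild IsTame LastTame HasSharpHyperplane)
open Summit.Schanuel.Schanuel.Theorems.RootDecomp1BDefectFloorDefs (SharpRelativeLindemannAt TameDefectZeroAt
  WildSharpDefectZeroAt WildSharpDefectZeroInitAt)
open Summit.Schanuel.Schanuel.Theorems.RootDecomp1BDefectFloorCells (natCast_le_trdeg_of_algebraicIndependent)
open Summit.Schanuel.Schanuel.Theorems.RootDecomp1BNesterenkoRadical (linearIndependent_pi_smul_pi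
  linearIndependent_smul_pi_pi lastTame_smul_pi_pi isTame_pi_smul_pi not_isWild_pi_smul_pi
  hasSharpHyperplane_pi_smul_pi polarDeg_init_pi_smul_pi_le not_liouville_pi)
open Summit.Schanuel.Schanuel.Theorems.RootDecomp1BRadicalDescent (UltraLiouville)
open Summit.Schanuel.Schanuel.Theorems.RootDecomp1KHyper.HyperCell (HyperLiouville lambdaH hyperLiouville_lambdaH)
open Summit.Schanuel.Schanuel.Theorems.RootDecomp1KGeneric (LiouvilleOrder)
open Summit.Schanuel.Schanuel.Theorems.RootDecomp1KFiniteOrderCell (towerNumber liouvilleOrder_towerNumber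
  liouville_towerNumber not_hyperLiouville_towerNumber not_liouvilleOrder_towerNumber towerNumber_pos)

/-- `e^{−2π} = q₀ = θ_N,0` (the logarithm `y₀ = −2π` of the base coordinate `i₀ = 0`). -/
theorem cexp_neg_two_pi : cexp (((-(2 * Real.pi) : ℝ)) : ℂ) = nesterenkoTriple 0 := by
  show _ = qN
  rw [qN, Complex.ofReal_exp]

/-- **THE STOREY-TWO TUPLE OVER `q₀` (`ρ > 0`).** `e^{−2πρ}, ρ, q₀, P(q₀), Q(q₀)` are algebraically independent over
`ℚ` for every real `ρ > 0` of exponential Liouville order `57` — HYPOTHESIS-FREE (§A measure + §B kernel). -/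
theorem algebraicIndependent_five_of_pos (hN : LogSizeMeasure 4 24 nesterenkoTriple) {ρ : ℝ} (hρ : LiouvilleOrder 57 ρ) (hρ0 : 0 < ρ) :
    AlgebraicIndependent ℚ
      (Fin.cons (cexp ((ρ : ℂ) * (((-(2 * Real.pi) : ℝ)) : ℂ))) (Fin.cons (ρ : ℂ) nesterenkoTriple) :
        Fin (3 + 2) → ℂ) :=
  algebraicIndependent_radical_of_logSizeMeasure hN (by norm_num) 0 cexp_neg_two_pi
    hρ (by norm_num) hρ0

/-- The four of them that live in the polar field: `e^{−2πρ}, ρ, q₀, P(q₀)` (`ρ > 0` of order `57`). -/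
theorem algebraicIndependent_four_of_pos (hN : LogSizeMeasure 4 24 nesterenkoTriple) {ρ : ℝ} (hρ : LiouvilleOrder 57 ρ) (hρ0 : 0 < ρ) :
    AlgebraicIndependent ℚ ![cexp ((ρ : ℂ) * (((-(2 * Real.pi) : ℝ)) : ℂ)), (ρ : ℂ), qN, ramanujanP qN] := by
  have h := (algebraicIndependent_five_of_pos hN hρ hρ0).comp (Fin.castLE (show 4 ≤ 3 + 2 by norm_num))
    (Fin.castLE_injective _)
  convert h using 1
  funext i
  fin_cases i <;> rfl

/-- `q₀ = (e^{π})^{−2}`. -/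
theorem qN_eq : qN = (cexp (Real.pi : ℂ))⁻¹ ^ 2 := by
  rw [qN, Complex.ofReal_exp, ← Complex.exp_neg, ← Complex.exp_nat_mul]
  congr 1
  push_cast
  ring

/-- **`t ≥ 4` for ANY subfield containing `π, e^π, ρ, e^{ρπ}`** (`ρ` of order `57`, either sign): the four numbers
`e^{∓2πρ} = (e^{ρπ})^{∓2}`, `±ρ`, `q₀ = (e^π)^{−2}`, `P(q₀) = 3/π` (Chowla–Selberg/Ramanujan, tree) lie in it. -/
theorem four_le_trdeg_of_mem (hN : LogSizeMeasure 4 24 nesterenkoTriple) {ρ : ℝ} (hρ : LiouvilleOrder 57 ρ) {L : IntermediateField ℚ ℂ}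
    (hπ : (Real.pi : ℂ) ∈ L) (he : cexp (Real.pi : ℂ) ∈ L) (hρm : (ρ : ℂ) ∈ L)
    (heρ : cexp ((ρ : ℂ) * (Real.pi : ℂ)) ∈ L) : ((2 + 2 : ℕ) : Cardinal) ≤ Algebra.trdeg ℚ ↥L := by
  have hρne : ρ ≠ 0 := hρ.ne_zero (by norm_num)
  have hq : qN ∈ L := by rw [qN_eq]; exact pow_mem (inv_mem he) 2
  have hP : ramanujanP qN ∈ L := by
    have e : ramanujanP qN = 3 / (Real.pi : ℂ) := ramanujan_values_exp_neg_two_pi_holds.1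
    rw [e]
    exact div_mem (ofNat_mem L 3) hπ
  rcases lt_or_gt_of_ne hρne with hneg | hpos
  · have hai := algebraicIndependent_four_of_pos hN hρ.neg (neg_pos.2 hneg)
    refine natCast_le_trdeg_of_algebraicIndependent hai fun i => ?_
    fin_cases i
    · show cexp ((((-ρ : ℝ)) : ℂ) * (((-(2 * Real.pi) : ℝ)) : ℂ)) ∈ L
      have e : cexp ((((-ρ : ℝ)) : ℂ) * (((-(2 * Real.pi) : ℝ)) : ℂ)) = cexp ((ρ : ℂ) * (Real.pi : ℂ)) ^ 2 := by
        rw [← Complex.exp_nat_mul]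
        congr 1
        push_cast
        ring
      rw [e]
      exact pow_mem heρ 2
    · show (((-ρ : ℝ)) : ℂ) ∈ L
      rw [Complex.ofReal_neg]
      exact neg_mem hρm
    · exact hq
    · exact hP
  · have hai := algebraicIndependent_four_of_pos hN hρ hpos
    refine natCast_le_trdeg_of_algebraicIndependent hai fun i => ?_
    fin_cases i
    · show cexp ((ρ : ℂ) * (((-(2 * Real.pi) : ℝ)) : ℂ)) ∈ L
      have e : cexp ((ρ : ℂ) * (((-(2 * Real.pi) : ℝ)) : ℂ)) = (cexp ((ρ : ℂ) * (Real.pi : ℂ)))⁻¹ ^ 2 := by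
        rw [← Complex.exp_neg, ← Complex.exp_nat_mul]
        congr 1
        push_cast
        ring
      rw [e]
      exact pow_mem (inv_mem heρ) 2
    · exact hρm
    · exact hq
    · exact hP

/-- **X(2)(π, ρπ): `t(π, ρπ) ≥ 4 = m + m` (`m = 2`)** for EVERY real `ρ` of exponential Liouville order `57` —
HYPOTHESIS-FREE. -/
theorem four_le_polarDeg_pi (hN : LogSizeMeasure 4 24 nesterenkoTriple) {ρ : ℝ} (hρ : LiouvilleOrder 57 ρ) :
    ((2 + 2 : ℕ) : Cardinal) ≤ polarDeg ![Real.pi, ρ * Real.pi] := by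
  have hπ : (Real.pi : ℂ) ∈ polarField ![Real.pi, ρ * Real.pi] := by
    simpa using coe_mem_polarField ![Real.pi, ρ * Real.pi] 0
  have he : cexp (Real.pi : ℂ) ∈ polarField ![Real.pi, ρ * Real.pi] := by
    simpa using exp_coe_mem_polarField ![Real.pi, ρ * Real.pi] 0
  have hρπ : (ρ : ℂ) * (Real.pi : ℂ) ∈ polarField ![Real.pi, ρ * Real.pi] := by
    simpa using coe_mem_polarField ![Real.pi, ρ * Real.pi] 1
  have heρ : cexp ((ρ : ℂ) * (Real.pi : ℂ)) ∈ polarField ![Real.pi, ρ * Real.pi] := by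
    simpa using exp_coe_mem_polarField ![Real.pi, ρ * Real.pi] 1
  have hπ0 : (Real.pi : ℂ) ≠ 0 := Complex.ofReal_ne_zero.mpr Real.pi_ne_zero
  have hρm : (ρ : ℂ) ∈ polarField ![Real.pi, ρ * Real.pi] := by
    have := div_mem hρπ hπ
    rwa [mul_div_cancel_right₀ _ hπ0] at this
  exact four_le_trdeg_of_mem hN hρ hπ he hρm heρ

/-- The same at the RE-BASED tuple `(ρπ | π)` (tame direction last). -/
theorem four_le_polarDeg_smul_pi_pi (hN : LogSizeMeasure 4 24 nesterenkoTriple) {ρ : ℝ} (hρ : LiouvilleOrder 57 ρ) :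
    ((2 + 2 : ℕ) : Cardinal) ≤ polarDeg ![ρ * Real.pi, Real.pi] := by
  have hπ : (Real.pi : ℂ) ∈ polarField ![ρ * Real.pi, Real.pi] := by
    simpa using coe_mem_polarField ![ρ * Real.pi, Real.pi] 1
  have he : cexp (Real.pi : ℂ) ∈ polarField ![ρ * Real.pi, Real.pi] := by
    simpa using exp_coe_mem_polarField ![ρ * Real.pi, Real.pi] 1
  have hρπ : (ρ : ℂ) * (Real.pi : ℂ) ∈ polarField ![ρ * Real.pi, Real.pi] := by
    simpa using coe_mem_polarField ![ρ * Real.pi, Real.pi] 0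
  have heρ : cexp ((ρ : ℂ) * (Real.pi : ℂ)) ∈ polarField ![ρ * Real.pi, Real.pi] := by
    simpa using exp_coe_mem_polarField ![ρ * Real.pi, Real.pi] 0
  have hπ0 : (Real.pi : ℂ) ≠ 0 := Complex.ofReal_ne_zero.mpr Real.pi_ne_zero
  have hρm : (ρ : ℂ) ∈ polarField ![ρ * Real.pi, Real.pi] := by
    have := div_mem hρπ hπ
    rwa [mul_div_cancel_right₀ _ hπ0] at this
  exact four_le_trdeg_of_mem hN hρ hπ he hρm heρ

/-- X(2)(π, ρπ) in the VERBATIM shape of the body of the 1B crux `KleinPolarSchanuel` (item 24622) at `m = 2`,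
`r = (π, ρπ)` — equivalently Schanuel's conjecture for the ℚ-free 4-tuple `z = (π, ρπ, iπ, iρπ)` — for every `ρ` of
order `57`, hypothesis-free. -/
theorem kleinPolarSchanuel_body_two_pi (hN : LogSizeMeasure 4 24 nesterenkoTriple) {ρ : ℝ} (hρ : LiouvilleOrder 57 ρ) :
    ((2 + 2 : ℕ) : Cardinal) ≤ Algebra.trdeg ℚ ↥(IntermediateField.adjoin ℚ
      (Set.range (Fin.append (fun j => ((![Real.pi, ρ * Real.pi] j : ℝ) : ℂ))
          (fun j => ((![Real.pi, ρ * Real.pi] j : ℝ) : ℂ) * Complex.I)) ∪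
        Set.range (Complex.exp ∘ Fin.append (fun j => ((![Real.pi, ρ * Real.pi] j : ℝ) : ℂ))
          (fun j => ((![Real.pi, ρ * Real.pi] j : ℝ) : ℂ) * Complex.I)))) :=
  four_le_polarDeg_pi hN hρ

/-- `t(π, ρπ) ≥ 3` (the floor, for the SRL step instance). -/
theorem three_le_polarDeg_pi (hN : LogSizeMeasure 4 24 nesterenkoTriple) {ρ : ℝ} (hρ : LiouvilleOrder 57 ρ) :
    ((1 + 1 + 1 : ℕ) : Cardinal) ≤ polarDeg ![Real.pi, ρ * Real.pi] :=
  (Nat.cast_le.2 (by norm_num)).trans (four_le_polarDeg_pi hN hρ)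

/-- `t(ρπ, π) ≥ 3`. -/
theorem three_le_polarDeg_smul_pi_pi (hN : LogSizeMeasure 4 24 nesterenkoTriple) {ρ : ℝ} (hρ : LiouvilleOrder 57 ρ) :
    ((1 + 1 + 1 : ℕ) : Cardinal) ≤ polarDeg ![ρ * Real.pi, Real.pi] :=
  (Nat.cast_le.2 (by norm_num)).trans (four_le_polarDeg_smul_pi_pi hN hρ)

/-! ### Every larger class: all finite orders `m ≥ 57`, hyper-Liouville, ultra-Liouville -/

/-- Every order `m ≥ 57`. -/
theorem four_le_polarDeg_pi_of_liouvilleOrder (hN : LogSizeMeasure 4 24 nesterenkoTriple) {ρ : ℝ} {m : ℕ} (hρ : LiouvilleOrder m ρ) (hm : 57 ≤ m) :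
    ((2 + 2 : ℕ) : Cardinal) ≤ polarDeg ![Real.pi, ρ * Real.pi] :=
  four_le_polarDeg_pi hN (hρ.mono hm)

/-- **Every HYPER-Liouville `ρ`** (the class of route 1K's item 33363) — hypothesis-free (critic rule B-R21 (d)). -/
theorem four_le_polarDeg_pi_hyper (hN : LogSizeMeasure 4 24 nesterenkoTriple) {ρ : ℝ} (hρ : HyperLiouville ρ) :
    ((2 + 2 : ℕ) : Cardinal) ≤ polarDeg ![Real.pi, ρ * Real.pi] :=
  four_le_polarDeg_pi hN (LiouvilleOrder.of_hyperLiouville hρ 57)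

/-- (ρπ | π), hyper. -/
theorem four_le_polarDeg_smul_pi_pi_hyper (hN : LogSizeMeasure 4 24 nesterenkoTriple) {ρ : ℝ} (hρ : HyperLiouville ρ) :
    ((2 + 2 : ℕ) : Cardinal) ≤ polarDeg ![ρ * Real.pi, Real.pi] :=
  four_le_polarDeg_smul_pi_pi hN (LiouvilleOrder.of_hyperLiouville hρ 57)

/-- **Every ULTRA-Liouville `ρ`: g33's `four_le_polarDeg_pi_ultra` with its hypothesis Cor. 5.2 (`h52`) REMOVED.** -/
theorem four_le_polarDeg_pi_ultra (hN : LogSizeMeasure 4 24 nesterenkoTriple) {ρ : ℝ} (hρ : UltraLiouville ρ) :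
    ((2 + 2 : ℕ) : Cardinal) ≤ polarDeg ![Real.pi, ρ * Real.pi] :=
  four_le_polarDeg_pi_hyper hN hρ.hyperLiouville

/-! ### The step cells of the 1B route at these tuples (ρ of order 57; all hypothesis-free) -/

/-- **SRLAt (π | ρπ)** — item 32406 AT `(π | ρπ)`: conclusion `t ≥ 3` holds. -/
theorem sharpRelativeLindemannAt_pi (hN : LogSizeMeasure 4 24 nesterenkoTriple) {ρ : ℝ} (hρ : LiouvilleOrder 57 ρ) :
    SharpRelativeLindemannAt 1 ![Real.pi, ρ * Real.pi] :=
  fun _ _ _ => three_le_polarDeg_pi hN hρ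

/-- **SRLAt (ρπ | π)**. -/
theorem sharpRelativeLindemannAt_smul_pi_pi (hN : LogSizeMeasure 4 24 nesterenkoTriple) {ρ : ℝ} (hρ : LiouvilleOrder 57 ρ) :
    SharpRelativeLindemannAt 1 ![ρ * Real.pi, Real.pi] :=
  fun _ _ _ => three_le_polarDeg_smul_pi_pi hN hρ

/-- **T0At (ρπ | π) — THE DECIDED TAME CELL** (item 32407 AT the re-based tuple, last coordinate `π` tame). -/
theorem tameDefectZeroAt_smul_pi_pi (hN : LogSizeMeasure 4 24 nesterenkoTriple) {ρ : ℝ} (hρ : LiouvilleOrder 57 ρ) :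
    TameDefectZeroAt 1 ![ρ * Real.pi, Real.pi] :=
  fun _ _ _ _ => four_le_polarDeg_smul_pi_pi hN hρ

/-- … NOT vacuous: apart from `KleinIH 2` (= X strictly below), every structural hypothesis of
`TameDefectZeroAt 1 (ρπ | π)` is a theorem — ℚ-free, `LastTame`, floor `t ≥ 3`. -/
theorem tameDefectZeroAt_smul_pi_pi_hypotheses (hN : LogSizeMeasure 4 24 nesterenkoTriple) {ρ : ℝ} (hρ : LiouvilleOrder 57 ρ) :
    LinearIndependent ℚ ![ρ * Real.pi, Real.pi] ∧ LastTame 1 ![ρ * Real.pi, Real.pi] ∧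
      ((1 + 1 + 1 : ℕ) : Cardinal) ≤ polarDeg ![ρ * Real.pi, Real.pi] :=
  ⟨linearIndependent_smul_pi_pi (hρ.irrational (by norm_num)), lastTame_smul_pi_pi ρ,
    three_le_polarDeg_smul_pi_pi hN hρ⟩

/-- **T0At (π | ρπ)**. -/
theorem tameDefectZeroAt_pi (hN : LogSizeMeasure 4 24 nesterenkoTriple) {ρ : ℝ} (hρ : LiouvilleOrder 57 ρ) : TameDefectZeroAt 1 ![Real.pi, ρ * Real.pi] :=
  fun _ _ _ _ => four_le_polarDeg_pi hN hρ

/-- **W0At (π | ρπ)** — item 32408 AT `(π | ρπ)`. -/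
theorem wildSharpDefectZeroAt_pi (hN : LogSizeMeasure 4 24 nesterenkoTriple) {ρ : ℝ} (hρ : LiouvilleOrder 57 ρ) :
    WildSharpDefectZeroAt 1 ![Real.pi, ρ * Real.pi] :=
  fun _ _ _ _ _ => four_le_polarDeg_pi hN hρ

/-- **W0InitAt (π | ρπ)** — the coordinate form. -/
theorem wildSharpDefectZeroInitAt_pi (hN : LogSizeMeasure 4 24 nesterenkoTriple) {ρ : ℝ} (hρ : LiouvilleOrder 57 ρ) :
    WildSharpDefectZeroInitAt 1 ![Real.pi, ρ * Real.pi] :=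
  fun _ _ _ _ _ => four_le_polarDeg_pi hN hρ

/-- SRL (π | ρπ) is NOT vacuous either: ℚ-free and sharp-init are theorems (tree part 03). -/
theorem sharpRelativeLindemannAt_pi_hypotheses' {ρ : ℝ} (hρ : LiouvilleOrder 57 ρ) :
    LinearIndependent ℚ ![Real.pi, ρ * Real.pi] ∧
      polarDeg (Fin.init ![Real.pi, ρ * Real.pi]) ≤ ((1 + 1 : ℕ) : Cardinal) :=
  ⟨linearIndependent_pi_smul_pi (hρ.irrational (by norm_num)), polarDeg_init_pi_smul_pi_le ρ⟩

/-! ### LIVE LINKS to route 1K: items 33363 (`HyperLiouvilleSchanuel`) and 33364 (`FiniteOrderLiouvilleSchanuel`),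
their `n = 4` instances at `z = (π, ρπ, iπ, iρπ)` in the items' verbatim binder shapes -/

/-- Item 33363 at `z = (π, ρπ, iπ, iρπ)`, `ρ` of order 57 (in particular every hyper-Liouville `ρ`): holds outright. -/
theorem hyperLiouvilleSchanuel_instance_pi (hN : LogSizeMeasure 4 24 nesterenkoTriple) {ρ : ℝ} (hρ : LiouvilleOrder 57 ρ) :
    LinearIndependent ℚ (Fin.append (fun j => ((![Real.pi, ρ * Real.pi] j : ℝ) : ℂ))
        (fun j => ((![Real.pi, ρ * Real.pi] j : ℝ) : ℂ) * Complex.I)) →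
      (∀ m : ℕ, ∃ h : Fin (2 + 2) → ℤ, h ≠ 0 ∧
        ‖∑ i, (h i : ℂ) * (Fin.append (fun j => ((![Real.pi, ρ * Real.pi] j : ℝ) : ℂ))
          (fun j => ((![Real.pi, ρ * Real.pi] j : ℝ) : ℂ) * Complex.I)) i‖ <
            Real.exp (-((1 + ∑ i, (|h i| : ℝ)) ^ m))) →
      ((2 + 2 : ℕ) : Cardinal) ≤ Algebra.trdeg ℚ ↥(IntermediateField.adjoin ℚ
        (Set.range (Fin.append (fun j => ((![Real.pi, ρ * Real.pi] j : ℝ) : ℂ))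
            (fun j => ((![Real.pi, ρ * Real.pi] j : ℝ) : ℂ) * Complex.I)) ∪
          Set.range (Complex.exp ∘ Fin.append (fun j => ((![Real.pi, ρ * Real.pi] j : ℝ) : ℂ))
            (fun j => ((![Real.pi, ρ * Real.pi] j : ℝ) : ℂ) * Complex.I)))) :=
  fun _ _ => four_le_polarDeg_pi hN hρ

/-- Item 33364 at `z = (π, ρπ, iπ, iρπ)`, `ρ` of order 57 (the item's own class: Liouville-as-a-form but NOT hyper —
e.g. `ρ = ρ_T` below): holds outright. -/
theorem finiteOrderLiouvilleSchanuel_instance_pi (hN : LogSizeMeasure 4 24 nesterenkoTriple) {ρ : ℝ} (hρ : LiouvilleOrder 57 ρ) :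
    LinearIndependent ℚ (Fin.append (fun j => ((![Real.pi, ρ * Real.pi] j : ℝ) : ℂ))
        (fun j => ((![Real.pi, ρ * Real.pi] j : ℝ) : ℂ) * Complex.I)) →
      (∀ ω : ℕ, ∃ h : Fin (2 + 2) → ℤ, h ≠ 0 ∧
        ‖∑ i, (h i : ℂ) * (Fin.append (fun j => ((![Real.pi, ρ * Real.pi] j : ℝ) : ℂ))
          (fun j => ((![Real.pi, ρ * Real.pi] j : ℝ) : ℂ) * Complex.I)) i‖ <
            1 / (1 + ∑ i, (|h i| : ℝ)) ^ ω) →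
      (¬ ∀ m : ℕ, ∃ h : Fin (2 + 2) → ℤ, h ≠ 0 ∧
        ‖∑ i, (h i : ℂ) * (Fin.append (fun j => ((![Real.pi, ρ * Real.pi] j : ℝ) : ℂ))
          (fun j => ((![Real.pi, ρ * Real.pi] j : ℝ) : ℂ) * Complex.I)) i‖ <
            Real.exp (-((1 + ∑ i, (|h i| : ℝ)) ^ m))) →
      ((2 + 2 : ℕ) : Cardinal) ≤ Algebra.trdeg ℚ ↥(IntermediateField.adjoin ℚ
        (Set.range (Fin.append (fun j => ((![Real.pi, ρ * Real.pi] j : ℝ) : ℂ))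
            (fun j => ((![Real.pi, ρ * Real.pi] j : ℝ) : ℂ) * Complex.I)) ∪
          Set.range (Complex.exp ∘ Fin.append (fun j => ((![Real.pi, ρ * Real.pi] j : ℝ) : ℂ))
            (fun j => ((![Real.pi, ρ * Real.pi] j : ℝ) : ℂ) * Complex.I)))) :=
  fun _ _ _ => four_le_polarDeg_pi hN hρ

end Cells

end Summit.Schanuel.Schanuel.Theorems.RootDecomp1BFiniteOrderRadical

end
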